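import Summits.Ventures.LatticeQCDFlow.Scaling.ProductRefreshStaleStructure
import Summits.Ventures.LatticeQCDFlow.Scaling.IdealStarKLogKLawFree

/-!
HONEST FRAMING: exact (Metropolis-corrected) sampling algorithms for lattice gauge theory; figures
of merit are autocorrelation/cost numbers at stated couplings and volumes; no continuum-physics
claim.

# ProductRefreshLawFreeFloor — THE LAW-FREE `½·log d` FLOOR FOR THE RANDOM-SCAN EXACT GIBBS SAMPLER OF ANY PRODUCT LAW `⊗μ_k` ON `S^d`: FROM ANY START `x` WITH `μ_k(x_k) ≤ ½` FOR ALL `k`,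
# `‖δ_xPⁿ − ⊗μ_k‖_TV ≥ 11/16` WHILE `Σ_k(1−w_k)ⁿ ≥ max{64, 8√(2d)}`, HENCE `t_mix(1/4) ≥ (d − 1)·log(d/max{64, 8√(2d)})` FOR EVERY SITE-SELECTION LAW `w` — THE HYPERCUBE ∕ EHRENFEST-URN
# LOWER BOUND (LEVIN–PERES–WILMER PROP. 7.14) IN THE TREE's GENERALITY; TWO-SIDED WITH CHAPTER L FILE R2's CEILING `⌈(log d + log 4)/w_min⌉` (lean-2 GEN-45, ours)

Venture-side (OURS).  Cell `lqcd-flow` (pub-lqcd), unit `pub-lqcd-lean-2-g45`, 2026-08-31.  Chapter AE, file 14 — file 7's argument for the product refresh chain `prodKernel w M` of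
chapter L files R1 ∕ R2 (exact redraws `M_k(u,·) = μ_k`; every positive product target; any site-selection probability vector `w`).  The stale set is the untouched set, whose chain
is chapter L file 2's touch chain with singletons (`s_n = Σ_k(1−w_k)ⁿ = E|D_n|`, `E|D_n|² ≤ s_n + s_n²`), so `P(|D_n| ≥ s_n/2) ≥ 1 − 4/s_n`; stale coordinates show `x` and clean
ones are an independent `⊗_{k∉D}μ_k`-sample (file 13 + R2), so the number of coordinates agreeing with the start is `|D_n|` plus a sum of independent indicators; with `μ_k(x_k) ≤ ½`
and `λ² = 2d` two Chebyshev steps give the floor; `Σ_k(1−w_k)ⁿ ≥ d(1−1/d)ⁿ` (Jensen, chapter L file 5) converts it to `(d−1)·log`.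

* `touch_singleton_rate`, **`touch_singleton_mass_ge`** (`(δ_{univ}Rⁿ){D : s_n/2 ≤ |D|} ≥ 1 − 4/s_n`), **`refresh_match_deficit_le`**, **`tensor_match_excess_le`**,
  **`refresh_tvDist_ge_lawFree`** (`TV ≥ 11/16` while `s_n ≥ max{64, 8√(2d)}`), **`refresh_mixingTime_ge_lawFree`** (**`t_mix(1/4) ≥ (d−1)·log(d/max{64, 8√(2d)})`**),
  **`refresh_mixingTime_two_sided_lawFree`** and **`_of_card`** (with R2: `(d−1)·log(d/max{64, 8√(2d)}) ≤ t_mix(1/4) ≤ ⌈(log d + log 4)/w_min⌉` for every positive product law once `|S| ≥ 2`).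

Reading (no numerics implied): chapter L's volume law (L9: `(|L|−1)·log(|L|η)` for ANY single-site dynamics) and R2's two-sided `d·log d` needed a start rare for the target
(`|S| ≥ 4d`); for exact redraws the half-logarithm is law-free — `(d/2)·log d` sweeps-times-sites is the price of equilibrating a product measure by random-scan heat bath from the
most ordinary start, two values per site sufficing.  NOT CLAIMED: non-product targets, systematic scan.  Literature grade (cell rule): KNOWN RESULT in the hypercube case (LPW Prop.
7.14), NEW TYPING for arbitrary product targets and site-selection laws; nothing cited as a fact; no new bib keys.
-/

noncomputable section

open Finset Function
open Literature.Probability.MarkovChains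

namespace Summit.Ventures.LatticeQCDFlow.Scaling

section ProductLawFree
variable {S : Type*} [Fintype S] [DecidableEq S] {d : ℕ} {μ : Fin d → S → ℝ} {M : Fin d → S → S → ℝ} {w : Fin d → ℝ}

omit [Fintype S] [DecidableEq S] in
/-- For the singleton touch sets the touch rate of coordinate `k` is `w_k`. [ours] -/
theorem touch_singleton_rate (w : Fin d → ℝ) (k : Fin d) : ∑ a ∈ univ.filter (fun a : Fin d => k ∈ ({a} : Finset (Fin d))), w a = w k := by
  classical
  rw [show univ.filter (fun a : Fin d => k ∈ ({a} : Finset (Fin d))) = {k} by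
    ext a; simp only [mem_filter, mem_univ, true_and, mem_singleton]; exact eq_comm]
  rw [sum_singleton]

omit [Fintype S] [DecidableEq S] in
/-- **THE UNTOUCHED COORDINATES SURVIVE THE COUPON-COLLECTOR TIME:** on the set chain `D ↦ D∖{k}` w.p. `w_k` from `univ`, with `s_n = Σ_k(1−w_k)ⁿ > 0`,
**`(δ_{univ}Rⁿ){D : s_n/2 ≤ |D|} ≥ 1 − 4/s_n`** (chapter L file 2's two moments with Chebyshev). [ours] -/
theorem touch_singleton_mass_ge (hw0 : ∀ k, 0 ≤ w k) (hw1 : ∑ k, w k = 1) {R : Finset (Fin d) → Finset (Fin d) → ℝ}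
    (hR : ∀ U V, R U V = ∑ k : Fin d, w k * (if V = U \ ({k} : Finset (Fin d)) then (1 : ℝ) else 0)) (n : ℕ) (hs : 0 < ∑ k : Fin d, (1 - w k) ^ n) :
    1 - 4 / (∑ k : Fin d, (1 - w k) ^ n)
      ≤ ∑ D ∈ univ.filter (fun D : Finset (Fin d) => (∑ k : Fin d, (1 - w k) ^ n) / 2 ≤ (D.card : ℝ)), lawAt R (Pi.single (univ : Finset (Fin d)) 1) n D := by
  classical
  set s : ℝ := ∑ k : Fin d, (1 - w k) ^ n with hs'
  have hT : ∀ a : Fin d, ∀ k ∈ (univ : Finset (Fin d)), ∀ l ∈ (univ : Finset (Fin d)), k ≠ l → ¬(k ∈ ({a} : Finset (Fin d)) ∧ l ∈ ({a} : Finset (Fin d))) := by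
    intro a k _ l _ hkl h
    rw [mem_singleton, mem_singleton] at h
    exact hkl (h.1.trans h.2.symm)
  have hmean := touch_lawAt_mean_count (c := w) (τ := fun a : Fin d => ({a} : Finset (Fin d))) hw1 hR univ n
  have hsq := touch_lawAt_sq_count_le (c := w) (τ := fun a : Fin d => ({a} : Finset (Fin d))) hw0 hw1 hR univ hT n
  simp_rw [touch_singleton_rate] at hmean hsq
  rw [← hs'] at hmean hsq
  have hRrs := touch_isRowStochastic (c := w) (τ := fun a : Fin d => ({a} : Finset (Fin d))) hw0 hw1 hR
  set ρ := lawAt R (Pi.single (univ : Finset (Fin d)) 1) n with hρ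
  have hρ0 : ∀ D, 0 ≤ ρ D := lawAt_nonneg hRrs (fun D => by rw [Pi.single_apply]; split_ifs <;> norm_num) n
  have hρ1 : ∑ D, ρ D = 1 := by rw [hρ, sum_lawAt hRrs, Finset.sum_pi_single']; simp
  -- the count as a function
  have hcount : ∀ V : Finset (Fin d), (∑ k ∈ (univ : Finset (Fin d)), (if k ∈ V then (1 : ℝ) else 0)) = (V.card : ℝ) := by
    intro V
    rw [← Finset.sum_filter, sum_const, nsmul_eq_mul, mul_one]
    congr 1; congr 1; ext k; simp
  unfold lawMean at hmean hsq
  simp_rw [hcount] at hmean hsq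
  -- Chebyshev
  have hvar : ∑ D, ρ D * ((D.card : ℝ) - s) ^ 2 ≤ s := by
    have e : ∀ D : Finset (Fin d), ρ D * ((D.card : ℝ) - s) ^ 2 = ρ D * (D.card : ℝ) ^ 2 - 2 * s * (ρ D * (D.card : ℝ)) + s ^ 2 * ρ D := fun D => by ring
    rw [sum_congr rfl fun D _ => e D, sum_add_distrib, sum_sub_distrib, ← mul_sum, ← mul_sum, hmean, hρ1]
    nlinarith
  have hbad : (∑ D ∈ univ.filter (fun D : Finset (Fin d) => ¬ (s / 2 ≤ (D.card : ℝ))), ρ D) * (s / 2) ^ 2 ≤ s := by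
    rw [sum_mul]
    calc ∑ D ∈ univ.filter (fun D : Finset (Fin d) => ¬ (s / 2 ≤ (D.card : ℝ))), ρ D * (s / 2) ^ 2
        ≤ ∑ D ∈ univ.filter (fun D : Finset (Fin d) => ¬ (s / 2 ≤ (D.card : ℝ))), ρ D * ((D.card : ℝ) - s) ^ 2 := by
          refine sum_le_sum fun D hD => mul_le_mul_of_nonneg_left ?_ (hρ0 D)
          have hlt : (D.card : ℝ) < s / 2 := not_le.mp (mem_filter.mp hD).2
          have h1 : s / 2 ≤ s - (D.card : ℝ) := by linarith
          calc (s / 2) ^ 2 ≤ (s - (D.card : ℝ)) ^ 2 := pow_le_pow_left₀ (by linarith) h1 2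
            _ = ((D.card : ℝ) - s) ^ 2 := by ring
      _ ≤ ∑ D, ρ D * ((D.card : ℝ) - s) ^ 2 := sum_le_sum_of_subset_of_nonneg (filter_subset _ _) fun D _ _ => mul_nonneg (hρ0 D) (sq_nonneg _)
      _ ≤ s := hvar
  have hsplit := Finset.sum_filter_add_sum_filter_not univ (fun D : Finset (Fin d) => s / 2 ≤ (D.card : ℝ)) ρ
  rw [hρ1] at hsplit
  have h4 : (∑ D ∈ univ.filter (fun D : Finset (Fin d) => ¬ (s / 2 ≤ (D.card : ℝ))), ρ D) ≤ s / (s / 2) ^ 2 := by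
    rw [le_div_iff₀ (by positivity)]; exact hbad
  have e : s / (s / 2) ^ 2 = 4 / s := by field_simp; ring
  rw [e] at h4
  linarith

/-- **THE CHAIN SIDE:** from `x` with `μ_k(x_k) ≤ ½` for every `k`, for `λ > 0` with `8λ ≤ s_n = Σ_k(1−w_k)ⁿ`:
**`(δ_xPⁿ){z : #{k : z_k = x_k} < Σ_kμ_k(x_k) + λ} ≤ 4/s_n + (Σ_kμ_k(x_k)(1−μ_k(x_k)))/λ²`**. [ours] -/
theorem refresh_match_deficit_le (hμ : ∀ k v, 0 < μ k v) (hμ1 : ∀ k, ∑ v, μ k v = 1) (hM : ∀ k, IsRowStochastic (M k))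
    (hMex : ∀ k u v, M k u v = μ k v) (hw0 : ∀ k, 0 ≤ w k) (hw1 : ∑ k, w k = 1)
    (x : Fin d → S) (hx : ∀ k, μ k (x k) ≤ 1 / 2) (n : ℕ) {lam : ℝ} (hlam : 0 < lam) (hs : 8 * lam ≤ ∑ k : Fin d, (1 - w k) ^ n) :
    ∑ z ∈ univ.filter (fun z : Fin d → S => ∑ k, (if z k = x k then (1 : ℝ) else 0) < ∑ k, μ k (x k) + lam), lawAt (prodKernel w M) (Pi.single x 1) n z
      ≤ 4 / (∑ k : Fin d, (1 - w k) ^ n) + (∑ k, μ k (x k) * (1 - μ k (x k))) / lam ^ 2 := by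
  classical
  obtain ⟨Ph, hPh⟩ : ∃ Ph : (Fin d → S) × Finset (Fin d) → (Fin d → S) × Finset (Fin d) → ℝ,
      ∀ p q, Ph p q = ∑ k : Fin d, w k * (coordKernel M k p.1 q.1 * (if q.2 = p.2 \ {k} then (1 : ℝ) else 0)) := ⟨fun p q => _, fun _ _ => rfl⟩
  obtain ⟨R, hR⟩ : ∃ R : Finset (Fin d) → Finset (Fin d) → ℝ, ∀ U V, R U V = ∑ k : Fin d, w k * (if V = U \ ({k} : Finset (Fin d)) then (1 : ℝ) else 0) := ⟨fun U V => _, fun _ _ => rfl⟩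
  set L := lawAt Ph (Pi.single (x, (univ : Finset (Fin d))) 1) n with hL
  have hfst := refresh_lawAt_fst (w := w) (M := M) hPh x n
  have hsnd := refresh_lawAt_snd (w := w) hM hPh hR x n
  have hfresh := refresh_fresh_lawAt (μ := μ) (w := w) hMex hPh x n
  have hsupp := refresh_lawAt_stale (w := w) (M := M) hPh x n
  have hPhrs := refresh_aug_isRowStochastic hw0 hw1 hM hPh
  have hL0 : ∀ p, 0 ≤ L p := lawAt_nonneg hPhrs (fun p => by rw [Pi.single_apply]; split_ifs <;> norm_num) n
  have hRrs := touch_isRowStochastic (c := w) (τ := fun a : Fin d => ({a} : Finset (Fin d))) hw0 hw1 hR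
  have hR1 : ∑ D, lawAt R (Pi.single (univ : Finset (Fin d)) 1) n D = 1 := by rw [sum_lawAt hRrs, Finset.sum_pi_single']; simp
  have hR0 : ∀ D, 0 ≤ lawAt R (Pi.single (univ : Finset (Fin d)) 1) n D := lawAt_nonneg hRrs (fun D => by rw [Pi.single_apply]; split_ifs <;> norm_num) n
  set s : ℝ := ∑ k : Fin d, (1 - w k) ^ n with hsdef
  have hspos : 0 < s := by linarith
  rw [sum_congr rfl fun z _ => (hfst z).symm, sum_comm]
  set m₀ : ℝ := 4 * lam with hm₀
  have hper : ∀ D : Finset (Fin d),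
      ∑ z ∈ univ.filter (fun z : Fin d → S => ∑ k, (if z k = x k then (1 : ℝ) else 0) < ∑ k, μ k (x k) + lam), L (z, D)
        ≤ (if (D.card : ℝ) < m₀ then ∑ z, L (z, D) else 0)
          + ∑ z ∈ univ.filter (fun z : Fin d → S => lam ^ 2 ≤ (∑ k ∈ univ \ D, (if z k = x k then (1 : ℝ) else 0) - ∑ k ∈ univ \ D, μ k (x k)) ^ 2), L (z, D) := by
    intro D
    by_cases hG : (D.card : ℝ) < m₀
    · rw [if_pos hG]
      have h1 : ∑ z ∈ univ.filter (fun z : Fin d → S => ∑ k, (if z k = x k then (1 : ℝ) else 0) < ∑ k, μ k (x k) + lam), L (z, D) ≤ ∑ z, L (z, D) :=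
        sum_le_sum_of_subset_of_nonneg (filter_subset _ _) fun z _ _ => hL0 _
      have h2 : 0 ≤ ∑ z ∈ univ.filter (fun z : Fin d → S => lam ^ 2 ≤ (∑ k ∈ univ \ D, (if z k = x k then (1 : ℝ) else 0) - ∑ k ∈ univ \ D, μ k (x k)) ^ 2), L (z, D) :=
        sum_nonneg fun z _ => hL0 _
      linarith
    · rw [if_neg hG, zero_add]
      push Not at hG
      rw [Finset.sum_filter, Finset.sum_filter]
      refine sum_le_sum fun z _ => ?_
      by_cases hdef : ∑ k, (if z k = x k then (1 : ℝ) else 0) < ∑ k, μ k (x k) + lam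
      · rw [if_pos hdef]
        by_cases hLz : L (z, D) = 0
        · rw [hLz]; split_ifs <;> exact le_rfl
        · have hz : ∀ k ∈ D, z k = x k := hsupp z D hLz
          have hcnt : ∑ k, (if z k = x k then (1 : ℝ) else 0) = (D.card : ℝ) + ∑ k ∈ univ \ D, (if z k = x k then (1 : ℝ) else 0) := by
            rw [← Finset.sum_add_sum_compl D, Finset.compl_eq_univ_sdiff]
            congr 1
            rw [sum_congr rfl fun k hk => if_pos (hz k hk), sum_const, nsmul_eq_mul, mul_one]
          have hesplit : ∑ k, μ k (x k) = ∑ k ∈ D, μ k (x k) + ∑ k ∈ univ \ D, μ k (x k) := by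
            rw [← Finset.sum_add_sum_compl D, Finset.compl_eq_univ_sdiff]
          have heD : ∑ k ∈ D, μ k (x k) ≤ (D.card : ℝ) / 2 := by
            calc ∑ k ∈ D, μ k (x k) ≤ ∑ _k ∈ D, (1 / 2 : ℝ) := sum_le_sum fun k _ => hx k
              _ = (D.card : ℝ) / 2 := by rw [sum_const, nsmul_eq_mul]; ring
          rw [hcnt, hesplit] at hdef
          have hdev : ∑ k ∈ univ \ D, (if z k = x k then (1 : ℝ) else 0) - ∑ k ∈ univ \ D, μ k (x k) ≤ -lam := by linarith
          have hsq : lam ^ 2 ≤ (∑ k ∈ univ \ D, (if z k = x k then (1 : ℝ) else 0) - ∑ k ∈ univ \ D, μ k (x k)) ^ 2 := by nlinarith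
          rw [if_pos hsq]
      · rw [if_neg hdef]; split_ifs <;> first | exact le_rfl | exact hL0 _
  refine (sum_le_sum fun D _ => hper D).trans ?_
  rw [sum_add_distrib]
  have hfirst : ∑ D : Finset (Fin d), (if (D.card : ℝ) < m₀ then ∑ z, L (z, D) else 0) ≤ 4 / s := by
    have e1 : ∑ D : Finset (Fin d), (if (D.card : ℝ) < m₀ then ∑ z, L (z, D) else 0)
        = ∑ D ∈ univ.filter (fun D : Finset (Fin d) => (D.card : ℝ) < m₀), lawAt R (Pi.single (univ : Finset (Fin d)) 1) n D := by
      rw [Finset.sum_filter]; refine sum_congr rfl fun D _ => ?_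
      rw [← hsnd D, hL]
    have hsub : ∑ D ∈ univ.filter (fun D : Finset (Fin d) => (D.card : ℝ) < m₀), lawAt R (Pi.single (univ : Finset (Fin d)) 1) n D
        ≤ ∑ D ∈ univ.filter (fun D : Finset (Fin d) => ¬ (s / 2 ≤ (D.card : ℝ))), lawAt R (Pi.single (univ : Finset (Fin d)) 1) n D :=
      sum_le_sum_of_subset_of_nonneg (fun D hD => by
        rw [mem_filter] at hD ⊢; exact ⟨hD.1, not_le.mpr (lt_of_lt_of_le hD.2 (by linarith))⟩) fun D _ _ => hR0 D
    have hsplit := Finset.sum_filter_add_sum_filter_not univ (fun D : Finset (Fin d) => s / 2 ≤ (D.card : ℝ))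
      (fun D => lawAt R (Pi.single (univ : Finset (Fin d)) 1) n D)
    rw [hR1] at hsplit
    have hmass := touch_singleton_mass_ge hw0 hw1 hR n hspos
    rw [← hsdef] at hmass
    rw [e1]; linarith
  have hsecond : ∑ D : Finset (Fin d), ∑ z ∈ univ.filter (fun z : Fin d → S => lam ^ 2 ≤ (∑ k ∈ univ \ D, (if z k = x k then (1 : ℝ) else 0) - ∑ k ∈ univ \ D, μ k (x k)) ^ 2), L (z, D)
      ≤ (∑ k, μ k (x k) * (1 - μ k (x k))) / lam ^ 2 := by
    have hlam2 : 0 < lam ^ 2 := by positivity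
    have hpk : ∀ k, 0 ≤ μ k (x k) * (1 - μ k (x k)) := fun k => mul_nonneg (hμ k (x k)).le (by linarith [hx k])
    have hD : ∀ D : Finset (Fin d), ∑ z ∈ univ.filter (fun z : Fin d → S => lam ^ 2 ≤ (∑ k ∈ univ \ D, (if z k = x k then (1 : ℝ) else 0) - ∑ k ∈ univ \ D, μ k (x k)) ^ 2), L (z, D)
        ≤ (∑ k, μ k (x k) * (1 - μ k (x k))) / lam ^ 2 * ∑ z, L (z, D) := by
      intro D
      have h := pfresh_match_chebyshev (ρ := fun z => L (z, D)) (fun z k v hk => hfresh z D k v hk) (fun z => hL0 _) hμ1 x hlam2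
      refine h.trans (mul_le_mul_of_nonneg_right ?_ (sum_nonneg fun z _ => hL0 _))
      exact div_le_div_of_nonneg_right (sum_le_sum_of_subset_of_nonneg (subset_univ _) fun k _ _ => hpk k) hlam2.le
    refine (sum_le_sum fun D _ => hD D).trans ?_
    rw [← mul_sum, sum_congr rfl fun D _ => hsnd D, hR1, mul_one]
  rw [hsdef] at hfirst
  linarith

omit [DecidableEq S] in
/-- **THE EQUILIBRIUM SIDE:** `(⊗μ_k){z : #{k : z_k = x_k} ≥ Σ_kμ_k(x_k) + λ} ≤ (Σ_kμ_k(x_k)(1−μ_k(x_k)))/λ²`. [ours] -/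
theorem tensor_match_excess_le [DecidableEq S] (hμ : ∀ k v, 0 < μ k v) (hμ1 : ∀ k, ∑ v, μ k v = 1) (x : Fin d → S) {lam : ℝ} (hlam : 0 < lam) :
    ∑ z ∈ univ.filter (fun z : Fin d → S => ∑ k, μ k (x k) + lam ≤ ∑ k, (if z k = x k then (1 : ℝ) else 0)), tensorFun μ z
      ≤ (∑ k, μ k (x k) * (1 - μ k (x k))) / lam ^ 2 := by
  classical
  have hlam2 : 0 < lam ^ 2 := by positivity
  have hρ : ∀ (z : Fin d → S) (k : Fin d) (v : S), k ∉ (∅ : Finset (Fin d)) → tensorFun μ (update z k v) * μ k (z k) = tensorFun μ z * μ k v := by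
    intro z k v _
    rw [tensorFun_update, tensorFun_eq_mul_prod μ z k]; ring
  have h := pfresh_match_chebyshev (D := (∅ : Finset (Fin d))) hρ (fun z => (tensorFun_pos hμ z).le) hμ1 x hlam2
  rw [sum_tensorFun_eq_one _ hμ1, mul_one, Finset.sdiff_empty] at h
  refine le_trans (sum_le_sum_of_subset_of_nonneg ?_ fun z _ _ => (tensorFun_pos hμ z).le) h
  intro z hz
  rw [mem_filter] at hz ⊢
  refine ⟨hz.1, ?_⟩
  have : lam ≤ ∑ k, (if z k = x k then (1 : ℝ) else 0) - ∑ k, μ k (x k) := by linarith [hz.2]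
  nlinarith

/-- **THE LAW-FREE FLOOR ON THE DISTANCE:** `μ_k(x_k) ≤ ½` for every `k`, `s_n = Σ_k(1−w_k)ⁿ ≥ 64` and `s_n ≥ 8√(2d)`:
**`‖δ_xPⁿ − ⊗μ_k‖_TV ≥ 11/16`**, witnessed by `{z : #{k : z_k = x_k} ≥ Σ_kμ_k(x_k) + √(2d)}`. [ours] -/
theorem refresh_tvDist_ge_lawFree (hμ : ∀ k v, 0 < μ k v) (hμ1 : ∀ k, ∑ v, μ k v = 1) (hM : ∀ k, IsRowStochastic (M k))
    (hMex : ∀ k u v, M k u v = μ k v) (hw0 : ∀ k, 0 ≤ w k) (hw1 : ∑ k, w k = 1)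
    (x : Fin d → S) (hx : ∀ k, μ k (x k) ≤ 1 / 2) (n : ℕ) (hs64 : 64 ≤ ∑ k : Fin d, (1 - w k) ^ n) (hs : 8 * Real.sqrt (2 * d) ≤ ∑ k : Fin d, (1 - w k) ^ n) (hd : 1 ≤ d) :
    11 / 16 ≤ tvDist (lawAt (prodKernel w M) (Pi.single x 1) n) (tensorFun μ) := by
  classical
  set lam : ℝ := Real.sqrt (2 * d) with hlamdef
  have hdpos : (0 : ℝ) < d := by exact_mod_cast (by omega : 0 < d)
  have hlam : 0 < lam := Real.sqrt_pos.mpr (by positivity)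
  have hlam2 : lam ^ 2 = 2 * d := Real.sq_sqrt (by positivity)
  set s : ℝ := ∑ k : Fin d, (1 - w k) ^ n with hsdef
  -- the variance proxy `Σ p(1−p) ≤ d/4`
  have hV : ∑ k, μ k (x k) * (1 - μ k (x k)) ≤ (d : ℝ) / 4 := by
    calc ∑ k, μ k (x k) * (1 - μ k (x k)) ≤ ∑ _k : Fin d, (1 / 4 : ℝ) := sum_le_sum fun k _ => by nlinarith [hx k, hμ k (x k)]
      _ = (d : ℝ) / 4 := by rw [sum_const, card_univ, Fintype.card_fin, nsmul_eq_mul]; ring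
  have hcheb : (∑ k, μ k (x k) * (1 - μ k (x k))) / lam ^ 2 ≤ 1 / 8 := by
    rw [hlam2, div_le_iff₀ (by positivity)]; linarith
  have hdef := refresh_match_deficit_le hμ hμ1 hM hMex hw0 hw1 x hx n hlam hs
  have hexc := tensor_match_excess_le hμ hμ1 x hlam
  have h4s : 4 / s ≤ 1 / 16 := by rw [div_le_div_iff₀ (by linarith) (by norm_num)]; linarith
  have hPrs : IsRowStochastic (prodKernel w M) := prodKernel_isRowStochastic (P := M) (w := w) hw0 hw1 hM
  have hl1 : ∑ z, lawAt (prodKernel w M) (Pi.single x 1) n z = ∑ z, tensorFun μ z := by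
    rw [sum_lawAt hPrs, Finset.sum_pi_single', if_pos (mem_univ _), sum_tensorFun_eq_one _ hμ1]
  have hl1' : ∑ z, lawAt (prodKernel w M) (Pi.single x 1) n z = 1 := by rw [hl1, sum_tensorFun_eq_one _ hμ1]
  have hAc : univ.filter (fun z : Fin d → S => ∑ k, (if z k = x k then (1 : ℝ) else 0) < ∑ k, μ k (x k) + lam)
      = univ.filter (fun z : Fin d → S => ¬ (∑ k, μ k (x k) + lam ≤ ∑ k, (if z k = x k then (1 : ℝ) else 0))) := by
    simp only [not_le]
  have hsplit := Finset.sum_filter_add_sum_filter_not univ (fun z : Fin d → S => ∑ k, μ k (x k) + lam ≤ ∑ k, (if z k = x k then (1 : ℝ) else 0))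
    (fun z => lawAt (prodKernel w M) (Pi.single x 1) n z)
  rw [hl1'] at hsplit
  rw [hAc] at hdef
  have htv := sub_sum_le_tvDist hl1 (univ.filter (fun z : Fin d → S => ∑ k, μ k (x k) + lam ≤ ∑ k, (if z k = x k then (1 : ℝ) else 0)))
  linarith

/-- **THE LAW-FREE `½·log d` FLOOR, as printed:** `d ≥ 2`, exact redraws, a positive site-selection law with `w_k ≥ w_min > 0`, any positive product target, any start `x` with
`μ_k(x_k) ≤ ½` for every `k`: **`t_mix(1/4) ≥ (d − 1)·log(d/max{64, 8√(2d)})`**. [ours] -/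
theorem refresh_mixingTime_ge_lawFree (hd : 2 ≤ d) (hμ : ∀ k v, 0 < μ k v) (hμ1 : ∀ k, ∑ v, μ k v = 1) (hM : ∀ k, IsRowStochastic (M k))
    (hMex : ∀ k u v, M k u v = μ k v) (hw0 : ∀ k, 0 ≤ w k) (hw1 : ∑ k, w k = 1) {wmin : ℝ} (hwmin0 : 0 < wmin) (hwmin : ∀ k, wmin ≤ w k)
    (x : Fin d → S) (hx : ∀ k, μ k (x k) ≤ 1 / 2) :
    ((d : ℝ) - 1) * Real.log ((d : ℝ) / max 64 (8 * Real.sqrt (2 * d))) ≤ (mixingTime (prodKernel w M) (tensorFun μ) (1 / 4) : ℝ) := by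
  classical
  set P := prodKernel w M with hP
  set C : ℝ := max 64 (8 * Real.sqrt (2 * d)) with hC
  have hd1 : 1 ≤ d := by omega
  have hdpos : (0 : ℝ) < d := by exact_mod_cast (by omega : 0 < d)
  have hd2 : (2 : ℝ) ≤ d := by exact_mod_cast hd
  have hCpos : 0 < C := lt_of_lt_of_le (by norm_num) (le_max_left _ _)
  have hθ0 : 0 < 1 / (d : ℝ) := by positivity
  have hθ1 : 1 / (d : ℝ) < 1 := by rw [div_lt_one hdpos]; linarith
  have hPrs : IsRowStochastic P := prodKernel_isRowStochastic (P := M) (w := w) hw0 hw1 hM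
  have hDB : DetailedBalance (tensorFun μ) P := prodKernel_detailedBalance (P := M) (refresh_detailedBalance hMex) w
  have hst : IsStationary (tensorFun μ) P := hDB.isStationary hPrs.2
  have hmix : ∃ t₀, worstTvDist P (tensorFun μ) t₀ ≤ 1 / 4 := by
    have hle := refresh_mixingTime_le (μ := μ) (M := M) (w := w) hd1 hμ hμ1 hM hMex hw0 hw1 hwmin0 hwmin (by norm_num : (0 : ℝ) < 1 / 4)
    -- some time is `¼`-close: the ceiling time itself (`worstTvDist_le_exp` at that time)
    refine ⟨⌈(Real.log d + Real.log (1 / (1 / 4 : ℝ))) / wmin⌉₊, ?_⟩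
    have h := refresh_worstTvDist_le_exp (μ := μ) (M := M) (w := w) hμ hμ1 hM hMex hw0 hw1 hwmin ⌈(Real.log d + Real.log (1 / (1 / 4 : ℝ))) / wmin⌉₊
    refine h.trans ?_
    have hn : (Real.log d + Real.log (1 / (1 / 4 : ℝ))) / wmin ≤ (⌈(Real.log d + Real.log (1 / (1 / 4 : ℝ))) / wmin⌉₊ : ℝ) := Nat.le_ceil _
    have h1 : Real.log d + Real.log (1 / (1 / 4 : ℝ)) ≤ (⌈(Real.log d + Real.log (1 / (1 / 4 : ℝ))) / wmin⌉₊ : ℝ) * wmin := by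
      rw [div_le_iff₀ hwmin0] at hn; exact hn
    calc (d : ℝ) * Real.exp (-((⌈(Real.log d + Real.log (1 / (1 / 4 : ℝ))) / wmin⌉₊ : ℝ) * wmin))
        ≤ (d : ℝ) * Real.exp (-(Real.log d + Real.log (1 / (1 / 4 : ℝ)))) := mul_le_mul_of_nonneg_left (Real.exp_le_exp.mpr (by linarith)) hdpos.le
      _ = 1 / 4 := by
          rw [Real.exp_neg, Real.exp_add, Real.exp_log hdpos, Real.exp_log (by norm_num)]
          field_simp
  -- Jensen: `s_n ≥ d(1−1/d)ⁿ`
  have hjensen : ∀ n : ℕ, (d : ℝ) * (1 - 1 / d) ^ n ≤ ∑ k : Fin d, (1 - w k) ^ n := by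
    intro n
    have h := sum_one_sub_pow_ge_jensen (univ : Finset (Fin d)) (Finset.univ_nonempty_iff.mpr ⟨⟨0, by omega⟩⟩) w
      (fun k _ => by calc w k ≤ ∑ j, w j := single_le_sum (fun j _ => hw0 j) (mem_univ k)
                       _ = 1 := hw1) n
    rw [card_univ, Fintype.card_fin, hw1] at h
    exact h
  by_contra h
  push Not at h
  set n := mixingTime P (tensorFun μ) (1 / 4) with hn
  have hconv : (d : ℝ) - 1 = (1 - 1 / d) / (1 / d) := by field_simp
  rw [hconv] at h
  have hge : C ≤ ∑ k : Fin d, (1 - w k) ^ n := by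
    have h1θ : 0 < 1 - 1 / (d : ℝ) := by linarith
    have hle := mul_le_mul_of_nonneg_left h.le (div_pos hθ0 h1θ).le
    have e0 : 1 / (d : ℝ) / (1 - 1 / d) * ((1 - 1 / d) / (1 / d)) = 1 := by
      rw [div_mul_div_comm, mul_comm (1 / (d : ℝ)) (1 - 1 / d)]; exact div_self (mul_ne_zero h1θ.ne' hθ0.ne')
    have e1 : 1 / (d : ℝ) / (1 - 1 / d) * ((1 - 1 / d) / (1 / d) * Real.log ((d : ℝ) / C)) = Real.log ((d : ℝ) / C) := by rw [← mul_assoc, e0, one_mul]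
    have e2 : 1 / (d : ℝ) / (1 - 1 / d) * (n : ℝ) = n * (1 / d) / (1 - 1 / d) := by ring
    rw [e1, e2] at hle
    calc C = (d : ℝ) * Real.exp (-Real.log ((d : ℝ) / C)) := by rw [Real.exp_neg, Real.exp_log (div_pos hdpos hCpos)]; field_simp
      _ ≤ (d : ℝ) * Real.exp (-(n * (1 / d) / (1 - 1 / d))) := mul_le_mul_of_nonneg_left (Real.exp_le_exp.mpr (neg_le_neg hle)) hdpos.le
      _ ≤ (d : ℝ) * (1 - 1 / d) ^ n := mul_le_mul_of_nonneg_left (one_sub_pow_ge_exp hθ1 n) hdpos.le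
      _ ≤ ∑ k : Fin d, (1 - w k) ^ n := hjensen n
  have hs64 : 64 ≤ ∑ k : Fin d, (1 - w k) ^ n := le_trans (le_max_left _ _) hge
  have hs8 : 8 * Real.sqrt (2 * d) ≤ ∑ k : Fin d, (1 - w k) ^ n := le_trans (le_max_right _ _) hge
  have hfloor := refresh_tvDist_ge_lawFree hμ hμ1 hM hMex hw0 hw1 x hx n hs64 hs8 hd1
  have hdn : worstTvDist P (tensorFun μ) n ≤ 1 / 4 := by
    obtain ⟨t₀, ht₀⟩ := hmix
    exact worstTvDist_le_of_mixingTime_le hPrs hst ht₀ le_rfl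
  have hwn := tvDist_single_le_worstTvDist P (tensorFun μ) n x
  linarith

/-- **THE TWO-SIDED `d·log d` LAW OF THE EXACT-REDRAW PRODUCT CHAIN FOR EVERY PRODUCT TARGET** (with chapter L file R2's ceiling): `d ≥ 2`, `0 < w_min ≤ w_k`, any positive product
target, any start with `μ_k(x_k) ≤ ½`: **`(d − 1)·log(d/max{64, 8√(2d)}) ≤ t_mix(1/4) ≤ ⌈(log d + log 4)/w_min⌉`**. [ours] -/
theorem refresh_mixingTime_two_sided_lawFree (hd : 2 ≤ d) (hμ : ∀ k v, 0 < μ k v) (hμ1 : ∀ k, ∑ v, μ k v = 1) (hM : ∀ k, IsRowStochastic (M k))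
    (hMex : ∀ k u v, M k u v = μ k v) (hw0 : ∀ k, 0 ≤ w k) (hw1 : ∑ k, w k = 1) {wmin : ℝ} (hwmin0 : 0 < wmin) (hwmin : ∀ k, wmin ≤ w k)
    (x : Fin d → S) (hx : ∀ k, μ k (x k) ≤ 1 / 2) :
    ((d : ℝ) - 1) * Real.log ((d : ℝ) / max 64 (8 * Real.sqrt (2 * d))) ≤ (mixingTime (prodKernel w M) (tensorFun μ) (1 / 4) : ℝ) ∧
      mixingTime (prodKernel w M) (tensorFun μ) (1 / 4) ≤ ⌈(Real.log d + Real.log (1 / (1 / 4 : ℝ))) / wmin⌉₊ :=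
  ⟨refresh_mixingTime_ge_lawFree hd hμ hμ1 hM hMex hw0 hw1 hwmin0 hwmin x hx,
    refresh_mixingTime_le (by omega) hμ hμ1 hM hMex hw0 hw1 hwmin0 hwmin (by norm_num)⟩

/-- **… ON EVERY `|S| ≥ 2`:** at every site a value of mass `≤ ½` exists, so the two-sided law holds for every positive product target. [ours] -/
theorem refresh_mixingTime_two_sided_lawFree_of_card (hS : 2 ≤ Fintype.card S) (hd : 2 ≤ d) (hμ : ∀ k v, 0 < μ k v) (hμ1 : ∀ k, ∑ v, μ k v = 1)
    (hM : ∀ k, IsRowStochastic (M k)) (hMex : ∀ k u v, M k u v = μ k v) (hw0 : ∀ k, 0 ≤ w k) (hw1 : ∑ k, w k = 1) {wmin : ℝ} (hwmin0 : 0 < wmin)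
    (hwmin : ∀ k, wmin ≤ w k) :
    ((d : ℝ) - 1) * Real.log ((d : ℝ) / max 64 (8 * Real.sqrt (2 * d))) ≤ (mixingTime (prodKernel w M) (tensorFun μ) (1 / 4) : ℝ) ∧
      mixingTime (prodKernel w M) (tensorFun μ) (1 / 4) ≤ ⌈(Real.log d + Real.log (1 / (1 / 4 : ℝ))) / wmin⌉₊ := by
  have hx : ∀ k : Fin d, ∃ u, μ k u ≤ 1 / 2 := fun k => exists_content_le_half hS (fun v => (hμ k v).le) (hμ1 k)
  choose x hx using hx
  exact refresh_mixingTime_two_sided_lawFree hd hμ hμ1 hM hMex hw0 hw1 hwmin0 hwmin x hx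

end ProductLawFree

end Summit.Ventures.LatticeQCDFlow.Scaling

end
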